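import Literature.Probability.RandomPlanarGeometry.KSRectangleExit
import HarnessLib

/-!
# Kemppainen–Smirnov's rectangle-exit bound with bounded centres
(line `crossing-martingale`, crux `CardyRigidity`, stub A2 `stub_percDrivingTail`)

Crux `Summit.CriticalPhenomena.CardyFormulaZ2.Theses.CardyUniqueLimit.CardyRigidity`
(stmt-CriticalPhenomena-0746), line `crossing_martingale`, stub A2 `stub_percDrivingTail`
(Kemppainen–Smirnov's Prop. 3.8 (1) for the bond-`ℤ²` exploration).  Its proof in print is
Prop. 3.7 (the rectangle-exit bound, tree: `KSRectangleExit.measure_reach_abs_re_le`) from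
Condition G2 read in `ℍ`.  The tree's form of Prop. 3.7 asks the boundary-annulus crossing bound
`hG` at EVERY real centre `z₀`; the printed proof (arXiv:1212.6215v3 p. 16: "Condition G2 can be
applied with the stopping times `0, τ_{J_1}, …, τ_{J_{n-1}}` and the annuli
`A(x_1,u,Cu), …, A(x_n,u,Cu)`", `x_k = Cu·k ≤ L`) uses it only at the centres `±x_k`,
`|x_k| ≤ |x₀| + n·Cu`.  For the raw (self-touching) lattice exploration read through
approximating chordal maps `φ_k`, the crossing bound is a statement at macroscopic scale in a
BOUNDED region of `ℍ̄` (eventually in the mesh); at centres near `φ_k⁻¹(b_k) = ∞` the images of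
the annuli are sub-mesh.  This file therefore re-proves Prop. 3.7 with the hypothesis restricted
to centres `|z₀| ≤ Z`, `Z ≥ |x₀| + n·Cu` — same proof, the induction being run only up to the
`n` lines actually used:

* `measure_reach_halfPlane_le_of_bddCentres` (one side), `measure_reach_abs_re_le_of_bddCentres`
  (both sides): under the crossing bound at centres `|z₀| ≤ Z`, the classes starting in
  `{|re| < x₀}` which reach `{|re| ≥ x₀ + n·Cu}` with initial segment in the strip `{|im| ≤ u}`
  have measure `≤ 2 · 2^{-n} μ(univ)` whenever `|x₀| + n·Cu ≤ Z`.

Adapted from `Literature/Probability/RandomPlanarGeometry/KSRectangleExit.lean` (same lemmas: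
`Curve.makesCrossing_startFrom_halfPlane`, `CurveClass.startFrom_halfPlane_mem_crossingIn`,
`CurveClass.range_stopAt_halfPlane_subset`, `measurableSet_rectanglePasts`).

References: A. Kemppainen, S. Smirnov, Ann. Probab. 45 (2017), §3.3 Prop. 3.7
(arXiv:1212.6215v3, p. 16).
-/

noncomputable section

open Set MeasureTheory Metric Filter Topology
open scoped unitInterval ENNReal
open Literature.Probability.RandomPlanarGeometry

namespace Summit.CriticalPhenomena.CardyFormulaZ2.Cruxes.CardyRigidity.CrossingMartingale

namespace KSBridge

variable {sgn : ℝ}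

/-- The centres used by Kemppainen–Smirnov's induction are bounded: for `k + 1 ≤ n`,
`|sgn·(x₀ + k·Cu + Cu)| ≤ |x₀| + n·Cu` (`sgn = ±1`, `Cu ≥ 0`). [folklore] -/
theorem abs_centre_le (hsgn : sgn = 1 ∨ sgn = -1) {x₀ C u : ℝ} (hCu : 0 ≤ C * u) {k n : ℕ}
    (hkn : k + 1 ≤ n) : |sgn * (x₀ + k * (C * u) + C * u)| ≤ |x₀| + n * (C * u) := by
  have habs : |sgn| = 1 := by rcases hsgn with rfl | rfl <;> simp
  rw [abs_mul, habs, one_mul]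
  have hk : ((k : ℝ) + 1) ≤ n := by exact_mod_cast hkn
  calc |x₀ + k * (C * u) + C * u| ≤ |x₀| + |k * (C * u) + C * u| := by
        rw [add_assoc]; exact abs_add_le _ _
    _ = |x₀| + ((k : ℝ) + 1) * (C * u) := by
        rw [abs_of_nonneg (show (0 : ℝ) ≤ k * (C * u) + C * u by positivity)]; ring
    _ ≤ |x₀| + n * (C * u) := by gcongr

/-- **Kemppainen–Smirnov's rectangle-exit bound, one side, with bounded centres** (Ann. Probab.
45 (2017), Prop. 3.7 and its proof). Let `μ` be a measure on curve classes satisfying the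
boundary-annulus instances of Condition G2 in `ℍ` at height `u > 0` with ratio `C > 1` AT THE
CENTRES `|z₀| ≤ Z`: for every nonempty closed `F`, every real centre `z₀` with `|z₀| ≤ Z` and every
measurable set `S` of pasts whose traces avoid the open disc `B(z₀, Cu)`,
`μ({stopAt F ∈ S} ∩ {startFrom F crosses A(z₀, u, Cu)}) ≤ ½ μ{stopAt F ∈ S}`. Then for every
threshold `x₀`, sign `sgn = ±1` and `n : ℕ` with `|x₀| + n·Cu ≤ Z`, the classes which start in
`{sgn·re < x₀}`, reach the half-plane `{sgn·re ≥ x₀ + n·Cu}`, and whose initial segment up to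
that hitting time stays in the strip `{|im| ≤ u}`, have measure at most `2^{-n} μ(univ)` (the
induction of `KSRectangleExit.measure_reach_halfPlane_le`, whose `k`-th step uses the centre
`sgn(x₀ + (k+1)·Cu)`, of modulus `≤ |x₀| + n·Cu`). [cite: KemppainenSmirnov2017, §3.3, Prop. 3.7] -/
theorem measure_reach_halfPlane_le_of_bddCentres (μ : Measure (CurveClass ℂ)) {C u Z : ℝ}
    (hsgn : sgn = 1 ∨ sgn = -1) (hC : 1 < C) (hu : 0 < u)
    (hG : ∀ F : Set ℂ, IsClosed F → F.Nonempty → ∀ z₀ : ℝ, |z₀| ≤ Z → ∀ S : Set (CurveClass ℂ),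
      MeasurableSet S → S ⊆ {p | Disjoint p.range (ball ((z₀ : ℝ) : ℂ) (C * u))} →
      μ (CurveClass.stopAt F ⁻¹' S ∩
          {c | c.startFrom F ∈ CurveClass.crossingIn ((z₀ : ℝ) : ℂ) u (C * u) univ}) ≤
        2⁻¹ * μ (CurveClass.stopAt F ⁻¹' S))
    (x₀ : ℝ) {n : ℕ} (hZ : |x₀| + n * (C * u) ≤ Z) :
    μ {c | sgn * c.source.re < x₀ ∧ (c.range ∩ {z : ℂ | x₀ + n * (C * u) ≤ sgn * z.re}).Nonempty ∧
        (c.stopAt {z : ℂ | x₀ + n * (C * u) ≤ sgn * z.re}).range ⊆ {z : ℂ | |z.im| ≤ u}} ≤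
      2⁻¹ ^ n * μ univ := by
  have hCu : 0 < C * u := mul_pos (zero_lt_one.trans hC) hu
  have huCu : u < C * u := lt_mul_left hu hC
  -- the lines `x k` and the events `E k`
  set x : ℕ → ℝ := fun k => x₀ + k * (C * u) with hx
  have hxsucc : ∀ k, x (k + 1) = x k + C * u := fun k => by
    simp only [hx, Nat.cast_succ]
    ring
  have hx0k : ∀ k : ℕ, x₀ ≤ x k := fun k => by
    simp only [hx]
    nlinarith [hCu.le, (Nat.cast_nonneg k : (0 : ℝ) ≤ k)]
  set H : ℕ → Set ℂ := fun k => {z : ℂ | x k ≤ sgn * z.re} with hH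
  set E : ℕ → Set (CurveClass ℂ) := fun k =>
    {c | sgn * c.source.re < x₀ ∧ (c.range ∩ H k).Nonempty ∧
      (c.stopAt (H k)).range ⊆ {z : ℂ | |z.im| ≤ u}} with hE
  -- the one-step bound, for the steps whose centre is within `Z`
  have hstep : ∀ k, k + 1 ≤ n → μ (E (k + 1)) ≤ 2⁻¹ * μ (E k) := by
    intro k hkn
    have hcentre : |sgn * (x k + C * u)| ≤ Z :=
      (abs_centre_le hsgn hCu.le hkn).trans hZ
    -- the set of pasts
    set S : Set (CurveClass ℂ) := {p | sgn * p.source.re < x₀ ∧ p.target ∈ H k ∧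
      p.range ⊆ {z : ℂ | |z.im| ≤ u} ∩ {z : ℂ | sgn * z.re ≤ x k}} with hS
    have hSm : MeasurableSet S := measurableSet_rectanglePasts sgn x₀ (x k) u
    have hSdisj : S ⊆ {p | Disjoint p.range (ball (((sgn * (x k + C * u)) : ℝ) : ℂ) (C * u))} := by
      rintro p ⟨-, -, hp⟩
      refine Set.disjoint_left.2 fun z hz hzb => ?_
      have hle : C * u ≤ dist z (((sgn * (x k + C * u)) : ℝ) : ℂ) :=
        le_dist_ofReal_of_mul_re_le hsgn (hp hz).2 hCu.le
      exact absurd (mem_ball.1 hzb) (not_lt.2 hle)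
    -- `{stopAt (H k) ∈ S} = E k`
    have hpre : CurveClass.stopAt (H k) ⁻¹' S = E k := by
      ext c
      simp only [mem_preimage, hS, hE, mem_setOf_eq]
      constructor
      · rintro ⟨h0, htgt, hrange⟩
        rw [CurveClass.source_stopAt] at h0
        refine ⟨h0, ?_, fun z hz => (hrange hz).1⟩
        refine ⟨(c.stopAt (H k)).target, ?_, htgt⟩
        exact CurveClass.range_stopAt_subset _ c (CurveClass.target_mem_range _)
      · rintro ⟨h0, hhit, hrange⟩
        refine ⟨by rwa [CurveClass.source_stopAt], ?_, fun z hz => ⟨hrange hz, ?_⟩⟩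
        · have hhit' : ∃ t, c.out t ∈ H k := CurveClass.exists_out_apply_mem_iff.2 hhit
          show (CurveClass.mk (c.out.stopAt (H k))).target ∈ H k
          rw [CurveClass.target_mk, Curve.target_stopAt]
          exact Curve.apply_hitParam_mem (isClosed_setOf_le_mul_re sgn (x k)) hhit'
        · exact CurveClass.range_stopAt_halfPlane_subset (h0.trans_le (hx0k k)) hz
    -- `E (k+1) ⊆ {stopAt (H k) ∈ S} ∩ {future crosses}`
    have hsub : E (k + 1) ⊆ CurveClass.stopAt (H k) ⁻¹' S ∩
        {c | c.startFrom (H k) ∈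
          CurveClass.crossingIn (((sgn * (x k + C * u)) : ℝ) : ℂ) u (C * u) univ} := by
      intro c hc
      obtain ⟨h0, hhit, hrange⟩ := hc
      have hHsub : H (k + 1) ⊆ H k := fun z hz => by
        show x k ≤ sgn * z.re
        have hz' : x (k + 1) ≤ sgn * z.re := hz
        rw [hxsucc] at hz'
        linarith
      refine ⟨?_, ?_⟩
      · rw [hpre]
        exact ⟨h0, hhit.mono (inter_subset_inter_right _ hHsub),
          (CurveClass.range_stopAt_mono hHsub c).trans hrange⟩
      · have hhit' : (c.range ∩ {z : ℂ | x k + C * u ≤ sgn * z.re}).Nonempty := by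
          rw [← hxsucc]; exact hhit
        have hrange' : (c.stopAt {z : ℂ | x k + C * u ≤ sgn * z.re}).range ⊆
            {z : ℂ | |z.im| ≤ u} := by
          rw [← hxsucc]; exact hrange
        exact CurveClass.startFrom_halfPlane_mem_crossingIn hsgn hu.le huCu
          (h0.trans_le (hx0k k)) hhit' hrange'
    calc μ (E (k + 1))
        ≤ μ (CurveClass.stopAt (H k) ⁻¹' S ∩ {c | c.startFrom (H k) ∈
            CurveClass.crossingIn (((sgn * (x k + C * u)) : ℝ) : ℂ) u (C * u) univ}) :=
          measure_mono hsub
      _ ≤ 2⁻¹ * μ (CurveClass.stopAt (H k) ⁻¹' S) :=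
          hG (H k) (isClosed_setOf_le_mul_re sgn (x k)) (setOf_le_mul_re_nonempty hsgn (x k)) _
            hcentre S hSm hSdisj
      _ = 2⁻¹ * μ (E k) := by rw [hpre]
  -- induction up to `n`
  have hind : ∀ k, k ≤ n → μ (E k) ≤ 2⁻¹ ^ k * μ univ := by
    intro k
    induction k with
    | zero => intro; simpa using measure_mono (subset_univ (E 0))
    | succ k ih =>
      intro hk
      calc μ (E (k + 1)) ≤ 2⁻¹ * μ (E k) := hstep k hk
        _ ≤ 2⁻¹ * (2⁻¹ ^ k * μ univ) := by gcongr; exact ih (Nat.le_of_succ_le hk)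
        _ = 2⁻¹ ^ (k + 1) * μ univ := by rw [pow_succ, ← mul_assoc, mul_comm (2⁻¹ ^ k)]
  exact hind n le_rfl

/-- **Kemppainen–Smirnov's rectangle-exit bound, both sides, with bounded centres** (Ann.
Probab. 45 (2017), Prop. 3.7: "`P(Re[(Φγ)(τ_{R_{L,u}})] = ±L) ≤ K e^{-cL/u}`"). Under the
boundary-annulus crossing bound of `measure_reach_halfPlane_le_of_bddCentres` at the centres
`|z₀| ≤ Z`, for `|x₀| + n·Cu ≤ Z` the classes which start in `{|re| < x₀}`, reach
`{|re| ≥ x₀ + n·Cu}`, and whose initial segment up to that hitting time stays in the strip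
`{|im| ≤ u}`, have measure at most `2 · 2^{-n} μ(univ)` (split according to the side of the first
hitting point, as in `KSRectangleExit.measure_reach_abs_re_le`).
[cite: KemppainenSmirnov2017, §3.3, Prop. 3.7] -/
theorem measure_reach_abs_re_le_of_bddCentres (μ : Measure (CurveClass ℂ)) {C u Z : ℝ}
    (hC : 1 < C) (hu : 0 < u)
    (hG : ∀ F : Set ℂ, IsClosed F → F.Nonempty → ∀ z₀ : ℝ, |z₀| ≤ Z → ∀ S : Set (CurveClass ℂ),
      MeasurableSet S → S ⊆ {p | Disjoint p.range (ball ((z₀ : ℝ) : ℂ) (C * u))} →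
      μ (CurveClass.stopAt F ⁻¹' S ∩
          {c | c.startFrom F ∈ CurveClass.crossingIn ((z₀ : ℝ) : ℂ) u (C * u) univ}) ≤
        2⁻¹ * μ (CurveClass.stopAt F ⁻¹' S))
    (x₀ : ℝ) {n : ℕ} (hZ : |x₀| + n * (C * u) ≤ Z) :
    μ {c | |c.source.re| < x₀ ∧ (c.range ∩ {z : ℂ | x₀ + n * (C * u) ≤ |z.re|}).Nonempty ∧
        (c.stopAt {z : ℂ | x₀ + n * (C * u) ≤ |z.re|}).range ⊆ {z : ℂ | |z.im| ≤ u}} ≤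
      2 * 2⁻¹ ^ n * μ univ := by
  set L : ℝ := x₀ + n * (C * u) with hL
  set F : Set ℂ := {z : ℂ | L ≤ |z.re|} with hF
  have hFc : IsClosed F := isClosed_le continuous_const (continuous_abs.comp Complex.continuous_re)
  -- the one-sided events
  set Ev : ℝ → Set (CurveClass ℂ) := fun sgn =>
    {c | sgn * c.source.re < x₀ ∧ (c.range ∩ {z : ℂ | x₀ + n * (C * u) ≤ sgn * z.re}).Nonempty ∧
      (c.stopAt {z : ℂ | x₀ + n * (C * u) ≤ sgn * z.re}).range ⊆ {z : ℂ | |z.im| ≤ u}} with hEv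
  -- reduction of a class hitting `F` first on the side `sgn` to the one-sided event
  have key : ∀ (sgn : ℝ) (c : CurveClass ℂ), sgn * c.source.re < x₀ →
      (c.stopAt F).range ⊆ {z : ℂ | |z.im| ≤ u} → (∃ t, c.out t ∈ F) →
      L ≤ sgn * (c.out ⟨c.out.hitParam F, c.out.hitParam_mem_Icc F⟩).re →
      {z : ℂ | L ≤ sgn * z.re} ⊆ F → c ∈ Ev sgn := by
    intro sgn c h0 hstrip hhit hside hsub
    set H : Set ℂ := {z : ℂ | L ≤ sgn * z.re} with hH
    have hle : c.out.hitParam F ≤ c.out.hitParam H := Curve.hitParam_mono hsub c.out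
    have hge : c.out.hitParam H ≤ c.out.hitParam F :=
      Curve.hitParam_le (F := H) (t := ⟨c.out.hitParam F, c.out.hitParam_mem_Icc F⟩) hside
    have heq : c.out.stopAt H = c.out.stopAt F :=
      Curve.stopAt_eq_stopAt_of_hitParam_eq (le_antisymm hge hle)
    have heq' : c.stopAt H = c.stopAt F := by
      show CurveClass.mk (c.out.stopAt H) = CurveClass.mk (c.out.stopAt F)
      rw [heq]
    refine ⟨h0, ⟨c.out ⟨c.out.hitParam F, c.out.hitParam_mem_Icc F⟩, ?_, hside⟩, ?_⟩
    · rw [← CurveClass.range_out]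
      exact ⟨_, rfl⟩
    · show (c.stopAt H).range ⊆ _
      rw [heq']
      exact hstrip
  -- the two-sided event is covered by the two one-sided events
  have hcover : {c : CurveClass ℂ | |c.source.re| < x₀ ∧ (c.range ∩ F).Nonempty ∧
      (c.stopAt F).range ⊆ {z : ℂ | |z.im| ≤ u}} ⊆ Ev 1 ∪ Ev (-1) := by
    rintro c ⟨h0, hhit, hstrip⟩
    have hhit' : ∃ t, c.out t ∈ F := CurveClass.exists_out_apply_mem_iff.2 hhit
    have hp : c.out ⟨c.out.hitParam F, c.out.hitParam_mem_Icc F⟩ ∈ F :=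
      Curve.apply_hitParam_mem hFc hhit'
    have hpL : L ≤ |(c.out ⟨c.out.hitParam F, c.out.hitParam_mem_Icc F⟩).re| := hp
    have h0' := abs_lt.1 h0
    rcases le_or_gt 0 (c.out ⟨c.out.hitParam F, c.out.hitParam_mem_Icc F⟩).re with hre | hre
    · left
      refine key 1 c (by linarith) hstrip hhit' ?_ fun z hz => ?_
      · rw [abs_of_nonneg hre] at hpL
        linarith
      · show L ≤ |z.re|
        have hz' : L ≤ 1 * z.re := hz
        rw [one_mul] at hz'
        exact hz'.trans (le_abs_self _)
    · right
      refine key (-1) c (by linarith) hstrip hhit' ?_ fun z hz => ?_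
      · rw [abs_of_neg hre] at hpL
        linarith
      · show L ≤ |z.re|
        have hz' : L ≤ -1 * z.re := hz
        rw [neg_one_mul] at hz'
        exact hz'.trans (neg_le_abs _)
  calc μ {c | |c.source.re| < x₀ ∧ (c.range ∩ F).Nonempty ∧
          (c.stopAt F).range ⊆ {z : ℂ | |z.im| ≤ u}}
      ≤ μ (Ev 1 ∪ Ev (-1)) := measure_mono hcover
    _ ≤ μ (Ev 1) + μ (Ev (-1)) := measure_union_le _ _
    _ ≤ 2⁻¹ ^ n * μ univ + 2⁻¹ ^ n * μ univ :=
        add_le_add (measure_reach_halfPlane_le_of_bddCentres μ (Or.inl rfl) hC hu hG x₀ hZ)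
          (measure_reach_halfPlane_le_of_bddCentres μ (Or.inr rfl) hC hu hG x₀ hZ)
    _ = 2 * 2⁻¹ ^ n * μ univ := by rw [← two_mul, mul_assoc]

end KSBridge

/-- **Registered-shape form** (glue sub-goal `tail_rectangleExit_of_bddCentres` of
stmt-CriticalPhenomena-0746): Kemppainen–Smirnov's rectangle-exit bound (Prop. 3.7, both sides)
under the boundary-annulus crossing bound at the centres `|z₀| ≤ Z` only, for thresholds and
line counts with `|x₀| + n·Cu ≤ Z`. [cite: KemppainenSmirnov2017, §3.3, Prop. 3.7] -/
theorem tail_rectangleExit_of_bddCentres : ∀ (μ : MeasureTheory.Measure (CurveClass ℂ)) (C u Z : ℝ), 1 < C → 0 < u → (∀ F : Set ℂ, IsClosed F → F.Nonempty → ∀ z₀ : ℝ, |z₀| ≤ Z → ∀ S : Set (CurveClass ℂ), MeasurableSet S → S ⊆ {p | Disjoint p.range (Metric.ball ((z₀ : ℝ) : ℂ) (C * u))} → μ (CurveClass.stopAt F ⁻¹' S ∩ {c | c.startFrom F ∈ CurveClass.crossingIn ((z₀ : ℝ) : ℂ) u (C * u) Set.univ}) ≤ 2⁻¹ * μ (CurveClass.stopAt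 F ⁻¹' S)) → ∀ (x₀ : ℝ) (n : ℕ), |x₀| + n * (C * u) ≤ Z → μ {c | |c.source.re| < x₀ ∧ (c.range ∩ {z : ℂ | x₀ + n * (C * u) ≤ |z.re|}).Nonempty ∧ (c.stopAt {z : ℂ | x₀ + n * (C * u) ≤ |z.re|}).range ⊆ {z : ℂ | |z.im| ≤ u}} ≤ 2 * 2⁻¹ ^ n * μ Set.univ :=
  fun μ _ _ _ hC hu hG x₀ _ hZ ↦ KSBridge.measure_reach_abs_re_le_of_bddCentres μ hC hu hG x₀ hZ

end Summit.CriticalPhenomena.CardyFormulaZ2.Cruxes.CardyRigidity.CrossingMartingale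

end
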